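import Summits.QuantumFields.YangMills.Theorems.UnitScaleTiltProp7Crit93AtMemberOfRow84T3
import Summits.QuantumFields.YangMills.Theorems.UnitScaleTiltProp7HermDensityT3
import HarnessLib

/-!
# Route `UnitScaleTilt`, crux «MinimiserStabilityRegPr» (stmt-QuantumFields-19200, stub EX `stub_existenceMinimalOrbit`, route (α)) — «H128-OF-CRIT127 (assembly)»:
# **PRINT'S (128) AT THE T³ MEMBER FROM (127) + THE LATTICE (84) ROW** — S11's displayed row `h128` («`Δx(toL2 A′♭) + (Ĵ + Ŵ) = Q_k† μ`», Hilbert form, ★px5 ✓`Prop7SectET3LandauOpRowsEta`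
# ∕ ★px16 HDSOL-ETA) as a THEOREM modulo: `hCrit127` (ray criticality on ALL of `ker Q`, the conclusion of ✓`Prop7Crit127OfCrit93Split.hCrit127_of_hCrit93_of_split127`), the lattice (84)
# row `hZ` (lit ✓`B11Eq81ExpansionZpow.hasDerivAt_actionZ_chartRay_real`, rows at the `Δ^η` slot ✓`Prop7Rows84AtEtaSlot`), the chart conjugacy `hchart` and the reality of the chart value `hXR`
# NEAR `t = 0`, the traceless residual `hXtr`, and the three `QTwS` sector rows (theorems at `U₀ ∈ 𝔘_k(ε₀)`, ✓`Prop7QTwSRealityOfRegPr`) — the mirror of ✓`Prop7Crit93AtMemberOfRow84` read BACKWARDS.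

Cell `ym3-torus` (HUMAN RULING D-0037, YM ladder rung R3 — YM₃ on T³, NOT d = 4, NOT Clay; YM gap NOT proved), width seat `ym3-torus-px21` gen 3 (explicit-unit helper; lineage px21 g0∕g2:
✓`Prop7Crit127OfCrit93Split`, ✓`Prop7Crit93OfEq111`, ✓`Prop7Crit93AtMemberOfRow84`, ✓`Prop7Eq130OfEq128`, ✓`Prop7Rows84AtEtaSlot`, ✓`Prop7HermDensity`).  THEOREMS ONLY (0 `def`, 0 `sorry`);
`--supports stmt-QuantumFields-19200 --as helper`, count-neutral; NO claim on crux ∕ stub ∕ registry.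

THE PRINT.  [Balaban1985Variational] p. 297: «we obtain the following equation on A′₁, ⟨δA′, J⟩ + ⟨δA′, (Δ − Δ⁽²⁾)A′₁⟩ + ⟨δA′, ((δ∕δA′)V)(A′₁)⟩ = 0, (127) for all δA′ satisfying QδA′ = 0 …
the above equation can be written as ⟨δA′, J⟩ + ⟨δA′, Δ_aA′₁⟩ − … = 0 (128)» — i.e. the residual `J + Δ_aA′₁ + W(A′₁)` is orthogonal to `ker Q`, hence equals `Q*μ` ((129)–(130) solve it with
`G = Δ_a⁻¹`, `H₀ = GQ*(QGQ*)⁻¹`); (84) p. 290 «⟨(δ∕δA′)𝔉(A′), δA′⟩ = ⟨δA′, J⟩ + ⟨δA′, Δ₁A′⟩ + ⟨(δ∕δA′)V(A′), δA′⟩»; [Balaban1985BackgroundPropagators] (3.1) p. 390, (3.6)–(3.7) p. 391,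
(3.26) p. 395.  The chain (exactly the forward chain of ✓`deriv_chartRay_eq_zero_of_eq111_of_hasDerivAt_actionZ`, reversed): `hCrit127` says `deriv (t ↦ 𝒜(e^{(−i)χ(X + tδ)}U₀)) 0 = 0`
for every `𝔰𝔲(2)` direction `δ ∈ ker Q`; the lattice (84) (`hZ`) + the transport (act) ✓`actionZ_chartCfg_eq_actionRe` + `hchart` give the complexified action `g(t) = actionRe (chartU U₀ (χ(X + tδ)))`
the derivative `(η∕2)·(⟨δ′,J⟩ + ⟨δ′,Δ̂ₓA′⟩ + ⟨δ′,W⟩)`; the chart value is `SU(2)` near `t = 0` (`hXR`), so `g = (𝒜-ray : ℝ) ↪ ℂ` there (✓`actionRe_bgUnits`) and the derivative is the real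
number `deriv … 0 = 0` — hence the (84) sum VANISHES; in `L²` letters (✓`sum_pair27_eq_inner`) this is `⟪toL2 ιδ′, Δx(toL2 A′♭) + (Ĵ + Ŵ)⟫ = 0` for every Hermitian traceless `ιδ′ ∈ ker QTwS`
((128) in pairing form), and ✓`exists_eq_adjoint_Qk_of_hermitian_traceless` turns it into `∃ μ, Δx(toL2 A′♭) + (Ĵ + Ŵ) = Q_k† μ`.
SLOT REMARK.  Generic `Δx` and generic exponent-units chart `χ`; S11 instantiates `Δx := DeltaEtaSlot …` (print's `Δ_a`, ★★OWNER RULING g28-№9 ∕ ★w2-19200 g6 22:27:41Z), where the (84)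
row's `Δ̂ₓ := currentCLM … (Δx U₀)` is inhabited by lit (84) with ✓`Prop7Rows84AtEtaSlot`'s rows (Hermitian directions, no Landau condition — as (127) requires).
HONEST SCOPE.  Calculus glue + finite-dimensional linear algebra over landed letters; every estimate ∕ regime is displayed upstream; `hXR` is asked only NEAR `t = 0` (inhabitable by (51) on the
chart ball + continuity — the `∀ t` form would read `Dfix` off its ball); not a proof of any stub; nothing continuum ∕ OS ∕ mass-gap ∕ Clay.
-/

set_option autoImplicit false

noncomputable section

open scoped InnerProductSpace ComplexConjugate Matrix.Norms.L2Operator BigOperators Topology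
open Complex (I)

namespace Summit.QuantumFields.YangMills.Theorems.Prop7Eq128AtMemberOfCrit127

open Literature.MathematicalPhysics.QuantumFieldTheory.Balaban1983to89
open Literature.MathematicalPhysics.QuantumFieldTheory.Balaban1983to89.T3ContinuumYM3Torus
open NormedSpace (exp)
open T3PrintedRegularMinimiser (RegPr)
open B9SectCLatticeCarrier (Bond)
open B9Eq311L2Pairing (WL2)
open B11Eq115Space (NegSize Space115 JetSup NegSup)
open B11Eq111FrakG (nabla115)
open B11Eq103H1Complex (SiteL2K BondL2K funEquiv)
open B11Eq98CurrentSlot (Jcur)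
open B11Eq90Transpose (pair27)
open B11Eq90V0primeCurrent (Tsh Ucur curL flat115 flat115_apply)
open B9Eq3119DeltaPiCarrier (currentCLM)
open B9Eq39Adjoint (prodCfg)
open B9Eq31ActionZpow (actionZ)
open T3SectALandauChart (eta emb15 bgUnits)
open Summit.QuantumFields.YangMills.Theorems.Prop7TPrint (expHermField)
open Summit.QuantumFields.YangMills.Theorems.Prop7SectET3Transport (periodsT3 bondEquiv bgOfCfg)
open Summit.QuantumFields.YangMills.Theorems.Prop7SectET3HilbertLetters (W₂ frobEquiv toL2 DL2 DstarL2)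
open Summit.QuantumFields.YangMills.Theorems.Prop7SectET3CurvedPropagators
open Summit.QuantumFields.YangMills.Theorems.Prop7SymAvgTwSym (QTwS QTwS_star_comm_of_regPr QTwS_scalar_of_regPr QTwS_traceless_of_regPr)
open Summit.QuantumFields.YangMills.Theorems.Prop7SectET3WilsonHessian (chartU actionRe actionRe_bgUnits bgUnits_emb15_expHermField)
open Summit.QuantumFields.YangMills.Theorems.Prop7Crit93OfEq111 (sum_pair27_eq_inner)
open Summit.QuantumFields.YangMills.Theorems.Prop7ActionLatticeTransport (actionZ_chartCfg_eq_actionRe)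
open Summit.QuantumFields.YangMills.Theorems.Prop7HermDensity (exists_eq_adjoint_Qk_of_hermitian_traceless)

variable {F : T3Family} {n K : ℕ} {h : n ≤ K} {c₀ cB a : ℝ} [Fact (0 < c₀)] [Fact (0 < cB)]
  {Δx : GaugeField (F.P K) 0 (Matrix.specialUnitaryGroup (Fin 2) ℂ) → (BondL2K ℂ 3 (periodsT3 F K) c₀ W₂ →ₗ[ℂ] BondL2K ℂ 3 (periodsT3 F K) c₀ W₂)}
  [Fact (0 < (F.L : ℝ))] [Fact (0 < ((F.L : ℝ)⁻¹) ^ (K - n))]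

/-! ## §1 Reality of the complexified action on the chart at an `SU(2)` value -/

omit [Fact (0 < (F.L : ℝ))] in
/-- **THE COMPLEXIFIED ACTION AT AN `SU(2)` CHART VALUE IS THE (REAL) WILSON ACTION**: for Hermitian-traceless `H`, `actionRe (chartU U₀ (i•H)) = ↑(wilsonAction4 (emb15 U₀ (expHermField H)))`
(✓`bgUnits_emb15_expHermField` at `t = 1` + ✓`actionRe_bgUnits`). [cite: Balaban1985BackgroundPropagators, (3.1) p.390, (3.6) p.391; Balaban1987RG1, (0.2) p.252] -/
theorem actionRe_chartU_I_smul_eq_ofReal (U₀ : GaugeField (F.P K) 0 (Matrix.specialUnitaryGroup (Fin 2) ℂ)) {H : PBond (F.P K) 0 → Matrix (Fin 2) (Fin 2) ℂ}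
    (hH : ∀ b, (H b).IsHermitian ∧ Matrix.trace (H b) = 0) :
    actionRe F K (chartU F K U₀ (Complex.I • H)) = ((wilsonAction4 (emb15 U₀ (expHermField H)) : ℝ) : ℂ) := by
  have h1 := bgUnits_emb15_expHermField (F := F) (K := K) U₀ hH 1
  have hfun : (fun b => ((1 : ℝ) : ℂ) • H b) = H := funext fun b => by rw [Complex.ofReal_one, one_smul]
  rw [hfun, Complex.ofReal_one, one_smul] at h1
  rw [← h1, actionRe_bgUnits]

omit [Fact (0 < (F.L : ℝ))] in
/-- **THE SAME ALONG A GENERIC EXPONENT-UNITS CHART `χ`**: if `(−i)•χ(Y)` is Hermitian-traceless, `actionRe (chartU U₀ (χ Y)) = ↑(wilsonAction4 (emb15 U₀ (expHermField ((−i)•χ Y))))`.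
[cite: Balaban1985BackgroundPropagators, (3.1) p.390, (3.6) p.391; Balaban1985Variational, (51) p.286] -/
theorem actionRe_chartU_eq_ofReal_of_real (U₀ : GaugeField (F.P K) 0 (Matrix.specialUnitaryGroup (Fin 2) ℂ)) {Y : PBond (F.P K) 0 → Matrix (Fin 2) (Fin 2) ℂ}
    (hY : ∀ b', (((-Complex.I) • Y) b').IsHermitian ∧ Matrix.trace (((-Complex.I) • Y) b') = 0) :
    actionRe F K (chartU F K U₀ Y) = ((wilsonAction4 (emb15 U₀ (expHermField (fun b' => ((-Complex.I) • Y) b'))) : ℝ) : ℂ) := by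
  have hYI : Y = Complex.I • (fun b' => ((-Complex.I) • Y) b') := by
    funext b
    simp only [Pi.smul_apply, smul_smul, mul_neg, Complex.I_mul_I, neg_neg, one_smul]
  conv_lhs => rw [hYI]
  exact actionRe_chartU_I_smul_eq_ofReal U₀ (fun b => hY b)

/-! ## §2 ★★★ (128) in pairing form at ONE direction: `⟪toL2 ιδ′, Δx(toL2 A′♭) + (Ĵ + Ŵ)⟫ = 0` from `hCrit127` at `δ := κ_f • ιδ′` + the (84) row at `δ′` -/

/-- ★★★ **(128) IN PAIRING FORM AT ONE DIRECTION, FROM (127) + THE LATTICE (84) ROW** (generic slot `Δx`, generic chart `χ`, generic letters `W` (print's `(δ∕δA′)V`) and `Tc` (print's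
`A′ ↦ A′ − HD(A′)`)).  Data: the knit's `A₁`, datum `B`, the (115)-direction `δ′` with Hermitian route reading `ιδ′`; **`hZ`** = lit (84) at `δ′` (✓`B11Eq81ExpansionZpow.hasDerivAt_actionZ_chartRay_real`
at `Δ₁ := currentCLM … (Δx U₀)`, `A′ := A₁ + H₁f B`); **`hchart`** = the chart conjugacy near `t = 0` with the route direction `δ := (η·i) • ιδ′`; **`hXR`** = reality of the chart value NEAR `t = 0`
((51)); **`hCrit`** = `hCrit127` AT `δ` (print's (127), ray form).  Conclusion: `⟪toL2 ιδ′, Δx U₀ (toL2 A′♭) + (Ĵ + Ŵ)⟫_ℂ = 0` — the (84) sum is the derivative of a REAL function whose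
derivative vanishes.  [cite: Balaban1985Variational, (127)–(128) p.297, (84) p.290; Balaban1985BackgroundPropagators, (3.1) p.390, (3.6)–(3.7) p.391] -/
theorem inner_toL2_residual_eq_zero_of_hCrit127_of_hasDerivAt_actionZ
    (U₀ : GaugeField (F.P K) 0 (Matrix.specialUnitaryGroup (Fin 2) ℂ))
    (A₁ : Space115 (F.L : ℝ) (((F.L : ℝ)⁻¹) ^ (K - n)) (fun _ : Bond 3 (periodsT3 F K) => K - n) (fun _ : Bond 3 (periodsT3 F K) × Fin 3 => K - n)
      (nabla115 (((F.L : ℝ)⁻¹) ^ (K - n)) (bgOfCfg F K U₀)))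
    (W : Space115 (F.L : ℝ) (((F.L : ℝ)⁻¹) ^ (K - n)) (fun _ : Bond 3 (periodsT3 F K) => K - n) (fun _ : Bond 3 (periodsT3 F K) × Fin 3 => K - n)
        (nabla115 (((F.L : ℝ)⁻¹) ^ (K - n)) (bgOfCfg F K U₀)) →
      NegSize (F.L : ℝ) (((F.L : ℝ)⁻¹) ^ (K - n)) (fun _ : Bond 3 (periodsT3 F K) => K - n) 3 (Matrix (Fin 2) (Fin 2) ℂ))
    (Tc : Space115 (F.L : ℝ) (((F.L : ℝ)⁻¹) ^ (K - n)) (fun _ : Bond 3 (periodsT3 F K) => K - n) (fun _ : Bond 3 (periodsT3 F K) × Fin 3 => K - n)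
        (nabla115 (((F.L : ℝ)⁻¹) ^ (K - n)) (bgOfCfg F K U₀)) →
      Space115 (F.L : ℝ) (((F.L : ℝ)⁻¹) ^ (K - n)) (fun _ : Bond 3 (periodsT3 F K) => K - n) (fun _ : Bond 3 (periodsT3 F K) × Fin 3 => K - n)
        (nabla115 (((F.L : ℝ)⁻¹) ^ (K - n)) (bgOfCfg F K U₀)))
    (B : PBond (F.P n) 0 → Matrix (Fin 2) (Fin 2) ℂ)
    (χ : (PBond (F.P K) 0 → Matrix (Fin 2) (Fin 2) ℂ) → (PBond (F.P K) 0 → Matrix (Fin 2) (Fin 2) ℂ))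
    {δ' : Space115 (F.L : ℝ) (((F.L : ℝ)⁻¹) ^ (K - n)) (fun _ : Bond 3 (periodsT3 F K) => K - n) (fun _ : Bond 3 (periodsT3 F K) × Fin 3 => K - n)
      (nabla115 (((F.L : ℝ)⁻¹) ^ (K - n)) (bgOfCfg F K U₀))}
    (hδR : ∀ b : PBond (F.P K) 0, star (JetSup.equiv _ _ _ δ' (bondEquiv F K b)) = JetSup.equiv _ _ _ δ' (bondEquiv F K b))
    (hZ : HasDerivAt (fun t : ℝ => actionZ Tsh (((F.L : ℝ)⁻¹) ^ (K - n)) 3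
        ((LinearMap.toContinuousLinearMap (Matrix.traceLinearMap (Fin 2) ℂ ℂ) : Matrix (Fin 2) (Fin 2) ℂ →L[ℂ] ℂ) : Matrix (Fin 2) (Fin 2) ℂ →ₗ[ℂ] ℂ)
        (prodCfg (Ucur (bgOfCfg F K U₀)) (((F.L : ℝ)⁻¹) ^ (K - n)) (curL (flat115 (Tc (A₁ + H1f F n K h c₀ cB a Δx U₀ B + (t : ℂ) • δ'))))))
      (pair27 (LinearMap.toContinuousLinearMap (Matrix.traceLinearMap (Fin 2) ℂ ℂ)) (Jcur (bgOfCfg F K U₀) : NegSize (F.L : ℝ) (((F.L : ℝ)⁻¹) ^ (K - n)) (fun _ : Bond 3 (periodsT3 F K) => K - n) 3 (Matrix (Fin 2) (Fin 2) ℂ)) (flat115 δ')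
        + pair27 (LinearMap.toContinuousLinearMap (Matrix.traceLinearMap (Fin 2) ℂ ℂ))
            (currentCLM frobEquiv (fun _ : Bond 3 (periodsT3 F K) × Fin 3 => K - n) (nabla115 (((F.L : ℝ)⁻¹) ^ (K - n)) (bgOfCfg F K U₀)) (Δx U₀) (A₁ + H1f F n K h c₀ cB a Δx U₀ B))
            (flat115 δ')
        + pair27 (LinearMap.toContinuousLinearMap (Matrix.traceLinearMap (Fin 2) ℂ ℂ)) (W (A₁ + H1f F n K h c₀ cB a Δx U₀ B)) (flat115 δ')) 0)
    (hchart : ∀ᶠ t : ℝ in nhds 0,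
      ((((eta F n K : ℝ) : ℂ)) * Complex.I) • (fun b : PBond (F.P K) 0 => JetSup.equiv _ _ _ (Tc (A₁ + H1f F n K h c₀ cB a Δx U₀ B + (t : ℂ) • δ')) (bondEquiv F K b))
        = χ (((((eta F n K : ℝ) : ℂ)) * Complex.I) • ((fun b : PBond (F.P K) 0 => JetSup.equiv _ _ _ A₁ (bondEquiv F K b))
              + (fun b : PBond (F.P K) 0 => JetSup.equiv _ _ _ (H1f F n K h c₀ cB a Δx U₀ B) (bondEquiv F K b)))
            + (t : ℂ) • (((((eta F n K : ℝ) : ℂ)) * Complex.I) • fun b : PBond (F.P K) 0 => JetSup.equiv _ _ _ δ' (bondEquiv F K b))))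
    (hXR : ∀ᶠ t : ℝ in nhds 0, ∀ b' : PBond (F.P K) 0,
      (((-Complex.I) • χ (((((eta F n K : ℝ) : ℂ)) * Complex.I) • ((fun b : PBond (F.P K) 0 => JetSup.equiv _ _ _ A₁ (bondEquiv F K b))
              + (fun b : PBond (F.P K) 0 => JetSup.equiv _ _ _ (H1f F n K h c₀ cB a Δx U₀ B) (bondEquiv F K b)))
            + (t : ℂ) • (((((eta F n K : ℝ) : ℂ)) * Complex.I) • fun b : PBond (F.P K) 0 => JetSup.equiv _ _ _ δ' (bondEquiv F K b)))) b').IsHermitian ∧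
      Matrix.trace (((-Complex.I) • χ (((((eta F n K : ℝ) : ℂ)) * Complex.I) • ((fun b : PBond (F.P K) 0 => JetSup.equiv _ _ _ A₁ (bondEquiv F K b))
              + (fun b : PBond (F.P K) 0 => JetSup.equiv _ _ _ (H1f F n K h c₀ cB a Δx U₀ B) (bondEquiv F K b)))
            + (t : ℂ) • (((((eta F n K : ℝ) : ℂ)) * Complex.I) • fun b : PBond (F.P K) 0 => JetSup.equiv _ _ _ δ' (bondEquiv F K b)))) b') = 0)
    (hCrit : deriv (fun t : ℝ => wilsonAction4 (emb15 U₀ (expHermField (fun b' : PBond (F.P K) 0 => (-Complex.I) •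
      (χ (((((eta F n K : ℝ) : ℂ)) * Complex.I) • ((fun b : PBond (F.P K) 0 => JetSup.equiv _ _ _ A₁ (bondEquiv F K b))
          + (fun b : PBond (F.P K) 0 => JetSup.equiv _ _ _ (H1f F n K h c₀ cB a Δx U₀ B) (bondEquiv F K b)))
        + (t : ℂ) • (((((eta F n K : ℝ) : ℂ)) * Complex.I) • fun b : PBond (F.P K) 0 => JetSup.equiv _ _ _ δ' (bondEquiv F K b)))) b')))) 0 = 0) :
    ⟪toL2 F K c₀ (fun b : PBond (F.P K) 0 => JetSup.equiv _ _ _ δ' (bondEquiv F K b)),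
      Δx U₀ (toL2 F K c₀ ((fun b : PBond (F.P K) 0 => JetSup.equiv _ _ _ A₁ (bondEquiv F K b))
          + (fun b : PBond (F.P K) 0 => JetSup.equiv _ _ _ (H1f F n K h c₀ cB a Δx U₀ B) (bondEquiv F K b))))
        + (funEquiv frobEquiv (fun _ : Bond 3 (periodsT3 F K) => c₀)).symm
            (NegSup.equiv _ _ (Jcur (L := (F.L : ℝ)) (η := ((F.L : ℝ)⁻¹) ^ (K - n)) (lev₀ := fun _ : Bond 3 (periodsT3 F K) => K - n) (bgOfCfg F K U₀))
              + NegSup.equiv _ _ (W (A₁ + H1f F n K h c₀ cB a Δx U₀ B)))⟫_ℂ = 0 := by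
  -- abbreviations
  set X : PBond (F.P K) 0 → Matrix (Fin 2) (Fin 2) ℂ := ((((eta F n K : ℝ) : ℂ)) * Complex.I) •
    ((fun b : PBond (F.P K) 0 => JetSup.equiv _ _ _ A₁ (bondEquiv F K b)) + (fun b : PBond (F.P K) 0 => JetSup.equiv _ _ _ (H1f F n K h c₀ cB a Δx U₀ B) (bondEquiv F K b)))
    with hX
  set δ : PBond (F.P K) 0 → Matrix (Fin 2) (Fin 2) ℂ := ((((eta F n K : ℝ) : ℂ)) * Complex.I) • fun b : PBond (F.P K) 0 => JetSup.equiv _ _ _ δ' (bondEquiv F K b) with hδ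
  set g : ℝ → ℂ := fun t => actionRe F K (chartU F K U₀ (χ (X + (t : ℂ) • δ))) with hg
  set f : ℝ → ℝ := fun t => wilsonAction4 (emb15 U₀ (expHermField (fun b' : PBond (F.P K) 0 => (-Complex.I) • (χ (X + (t : ℂ) • δ)) b'))) with hfdef
  set S : ℂ := pair27 (LinearMap.toContinuousLinearMap (Matrix.traceLinearMap (Fin 2) ℂ ℂ)) (Jcur (bgOfCfg F K U₀) : NegSize (F.L : ℝ) (((F.L : ℝ)⁻¹) ^ (K - n)) (fun _ : Bond 3 (periodsT3 F K) => K - n) 3 (Matrix (Fin 2) (Fin 2) ℂ)) (flat115 δ')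
        + pair27 (LinearMap.toContinuousLinearMap (Matrix.traceLinearMap (Fin 2) ℂ ℂ))
            (currentCLM frobEquiv (fun _ : Bond 3 (periodsT3 F K) × Fin 3 => K - n) (nabla115 (((F.L : ℝ)⁻¹) ^ (K - n)) (bgOfCfg F K U₀)) (Δx U₀) (A₁ + H1f F n K h c₀ cB a Δx U₀ B))
            (flat115 δ')
        + pair27 (LinearMap.toContinuousLinearMap (Matrix.traceLinearMap (Fin 2) ℂ ℂ)) (W (A₁ + H1f F n K h c₀ cB a Δx U₀ B)) (flat115 δ') with hS
  have hηpos : (0 : ℝ) < eta F n K := T3SectALandauChart.eta_pos F n K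
  have hηne : (((eta F n K : ℝ) : ℂ)) ≠ 0 := Complex.ofReal_ne_zero.2 hηpos.ne'
  -- (act) + hchart: near `t = 0`, lit's `actionZ` along the lattice ray is `η⁻¹·2·g t`
  have hZ' : HasDerivAt (fun t : ℝ => (((eta F n K : ℝ) : ℂ))⁻¹ * (2 * g t)) S 0 := by
    refine hZ.congr_of_eventuallyEq ?_
    filter_upwards [hchart] with t ht
    have hact := actionZ_chartCfg_eq_actionRe (F := F) (K := K) U₀ (eta F n K) (Tc (A₁ + H1f F n K h c₀ cB a Δx U₀ B + (t : ℂ) • δ'))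
    rw [ht] at hact
    exact hact.symm
  -- undo the constant `2η⁻¹`
  have hg' := hZ'.const_mul ((((eta F n K : ℝ) : ℂ)) / 2)
  have hgfun : (fun t : ℝ => (((eta F n K : ℝ) : ℂ)) / 2 * ((((eta F n K : ℝ) : ℂ))⁻¹ * (2 * g t))) = g := by
    funext t
    field_simp
  rw [hgfun] at hg'
  -- reality near `0`: `g = (f : ℝ) ↪ ℂ`
  have hgf : g =ᶠ[nhds 0] fun t : ℝ => ((f t : ℝ) : ℂ) := by
    filter_upwards [hXR] with t ht
    exact actionRe_chartU_eq_ofReal_of_real U₀ ht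
  -- so `f = re ∘ g` near `0` has derivative `re((η∕2)·S)`, and `g` has the REAL derivative `↑(re((η∕2)·S))`
  have hf : HasDerivAt f (RCLike.re ((((eta F n K : ℝ) : ℂ)) / 2 * S)) 0 := by
    have hre := (Complex.reCLM.hasFDerivAt.comp_hasDerivAt (0 : ℝ) hg')
    refine (hre.congr_of_eventuallyEq ?_)
    filter_upwards [hgf] with t ht
    simp only [Function.comp_def, Complex.reCLM_apply, ht, Complex.ofReal_re]
  have hgR : HasDerivAt g ((((RCLike.re ((((eta F n K : ℝ) : ℂ)) / 2 * S)) : ℝ) : ℂ)) 0 := (hf.ofReal_comp).congr_of_eventuallyEq hgf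
  -- (127): `deriv f 0 = 0`, so `(η∕2)·S = ↑(re((η∕2)·S)) = 0`
  have hre0 : RCLike.re ((((eta F n K : ℝ) : ℂ)) / 2 * S) = 0 := by rw [← hf.deriv]; exact hCrit
  have hS0 : S = 0 := by
    have h := hg'.unique hgR
    rw [hre0] at h
    have h2 : (((eta F n K : ℝ) : ℂ)) / 2 ≠ 0 := div_ne_zero hηne two_ne_zero
    simpa [h2] using h
  -- the (84) sum in `L²` letters
  have hstar : star (fun b : PBond (F.P K) 0 => JetSup.equiv _ _ _ δ' (bondEquiv F K b)) = fun b : PBond (F.P K) 0 => JetSup.equiv _ _ _ δ' (bondEquiv F K b) :=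
    funext fun b => hδR b
  have hsum := sum_pair27_eq_inner (c₀ := c₀) U₀ (Δx U₀) (Jcur (bgOfCfg F K U₀)) (W (A₁ + H1f F n K h c₀ cB a Δx U₀ B)) (A₁ + H1f F n K h c₀ cB a Δx U₀ B) δ'
  rw [← hS, hS0, hstar] at hsum
  have hc : (c₀ : ℂ)⁻¹ ≠ 0 := inv_ne_zero (Complex.ofReal_ne_zero.2 (Fact.out : 0 < c₀).ne')
  have hη3 : ((((F.L : ℝ)⁻¹) ^ (K - n) : ℝ) : ℂ) ^ 3 ≠ 0 := pow_ne_zero 3 hηne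
  have hinner := (mul_eq_zero.1 hsum.symm).resolve_left hη3
  have hinner' := (mul_eq_zero.1 hinner).resolve_left hc
  have hfun : ((fun b : PBond (F.P K) 0 => JetSup.equiv _ _ _ A₁ (bondEquiv F K b))
        + (fun b : PBond (F.P K) 0 => JetSup.equiv _ _ _ (H1f F n K h c₀ cB a Δx U₀ B) (bondEquiv F K b)))
      = fun b : PBond (F.P K) 0 => JetSup.equiv _ _ _ (A₁ + H1f F n K h c₀ cB a Δx U₀ B) (bondEquiv F K b) := by
    funext b
    rfl
  rw [hfun, add_comm]
  exact hinner'

/-! ## §3 ★★★ (128) in range form: `∃ μ, Δx(toL2 A′♭) + (Ĵ + Ŵ) = Q_k† μ` — S11's `h128` text — from `hCrit127` + the (84) rows on the Hermitian-traceless part of `ker QTwS` -/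

/-- ★★★ **S11's ROW `h128` AT THE T³ MEMBER FROM `hCrit127` + THE LATTICE (84) ROWS** («H128-OF-CRIT127», assembly; generic slot `Δx`, generic chart `χ`, generic `W`, `Tc`).
Rows (each ∀ over the (115)-directions `δ′` whose route reading `ιδ′` is HERMITIAN, TRACELESS and in `ker QTwS U₀` — exactly the directions of `hCrit127`): **`hZ`** (lit (84)), **`hchart`** (chart
conjugacy near `0`, route direction `(η·i) • ιδ′`), **`hXR`** (reality of the chart value near `0`); **`hCrit127`** VERBATIM the conclusion of ✓`hCrit127_of_hCrit93_of_split127` with `Ker := (QTwS U₀ · = 0)` at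
the knit's point `X := (η·i) • (ιA₁ + ιH₁f B)` and chart `χ`; the `QTwS` sector rows **`hQ hQtr hQsc`** (✓`QTwS_sectors_of_regPr`); the traceless residual **`hXtr`**.  Conclusion:
`∃ μ, Δx U₀ (toL2 (ιA₁ + ιH₁f B)) + funEquiv⁻¹(NegSup.equiv J + NegSup.equiv (W A′)) = Q_k† μ` — the `h128` hypothesis of ✓`Prop7SectET3LandauOpRowsEta.secondOrder_of_eq128_opRowsEta_rho` ∕ HDSOL-ETA.
[cite: Balaban1985Variational, (127)–(128) p.297, (129)–(130) pp.297–298, (84) p.290, (51) p.286; Balaban1985BackgroundPropagators, (3.1) p.390, (3.6)–(3.7) p.391, (3.13)–(3.15) p.393, (3.26) p.395] -/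
theorem exists_eq_adjoint_Qk_of_hCrit127_of_hasDerivAt_actionZ
    (U₀ : GaugeField (F.P K) 0 (Matrix.specialUnitaryGroup (Fin 2) ℂ))
    (hQ : ∀ A : PBond (F.P K) 0 → Matrix (Fin 2) (Fin 2) ℂ, QTwS F n K h U₀ (star A) = star (QTwS F n K h U₀ A))
    (hQtr : ∀ A : PBond (F.P K) 0 → Matrix (Fin 2) (Fin 2) ℂ, (∀ b, (A b).trace = 0) → ∀ c, (QTwS F n K h U₀ A c).trace = 0)
    (hQsc : ∀ c : PBond (F.P K) 0 → ℂ, ∃ d : PBond (F.P n) 0 → ℂ, QTwS F n K h U₀ (fun b => c b • (1 : Matrix (Fin 2) (Fin 2) ℂ)) = fun c' => d c' • 1)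
    (A₁ : Space115 (F.L : ℝ) (((F.L : ℝ)⁻¹) ^ (K - n)) (fun _ : Bond 3 (periodsT3 F K) => K - n) (fun _ : Bond 3 (periodsT3 F K) × Fin 3 => K - n)
      (nabla115 (((F.L : ℝ)⁻¹) ^ (K - n)) (bgOfCfg F K U₀)))
    (W : Space115 (F.L : ℝ) (((F.L : ℝ)⁻¹) ^ (K - n)) (fun _ : Bond 3 (periodsT3 F K) => K - n) (fun _ : Bond 3 (periodsT3 F K) × Fin 3 => K - n)
        (nabla115 (((F.L : ℝ)⁻¹) ^ (K - n)) (bgOfCfg F K U₀)) →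
      NegSize (F.L : ℝ) (((F.L : ℝ)⁻¹) ^ (K - n)) (fun _ : Bond 3 (periodsT3 F K) => K - n) 3 (Matrix (Fin 2) (Fin 2) ℂ))
    (Tc : Space115 (F.L : ℝ) (((F.L : ℝ)⁻¹) ^ (K - n)) (fun _ : Bond 3 (periodsT3 F K) => K - n) (fun _ : Bond 3 (periodsT3 F K) × Fin 3 => K - n)
        (nabla115 (((F.L : ℝ)⁻¹) ^ (K - n)) (bgOfCfg F K U₀)) →
      Space115 (F.L : ℝ) (((F.L : ℝ)⁻¹) ^ (K - n)) (fun _ : Bond 3 (periodsT3 F K) => K - n) (fun _ : Bond 3 (periodsT3 F K) × Fin 3 => K - n)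
        (nabla115 (((F.L : ℝ)⁻¹) ^ (K - n)) (bgOfCfg F K U₀)))
    (B : PBond (F.P n) 0 → Matrix (Fin 2) (Fin 2) ℂ)
    (χ : (PBond (F.P K) 0 → Matrix (Fin 2) (Fin 2) ℂ) → (PBond (F.P K) 0 → Matrix (Fin 2) (Fin 2) ℂ))
    (hZ : ∀ δ' : Space115 (F.L : ℝ) (((F.L : ℝ)⁻¹) ^ (K - n)) (fun _ : Bond 3 (periodsT3 F K) => K - n) (fun _ : Bond 3 (periodsT3 F K) × Fin 3 => K - n)
        (nabla115 (((F.L : ℝ)⁻¹) ^ (K - n)) (bgOfCfg F K U₀)),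
      (∀ b : PBond (F.P K) 0, star (JetSup.equiv _ _ _ δ' (bondEquiv F K b)) = JetSup.equiv _ _ _ δ' (bondEquiv F K b)) →
      (∀ b : PBond (F.P K) 0, Matrix.trace (JetSup.equiv _ _ _ δ' (bondEquiv F K b)) = 0) →
      QTwS F n K h U₀ (fun b : PBond (F.P K) 0 => JetSup.equiv _ _ _ δ' (bondEquiv F K b)) = 0 →
      HasDerivAt (fun t : ℝ => actionZ Tsh (((F.L : ℝ)⁻¹) ^ (K - n)) 3
        ((LinearMap.toContinuousLinearMap (Matrix.traceLinearMap (Fin 2) ℂ ℂ) : Matrix (Fin 2) (Fin 2) ℂ →L[ℂ] ℂ) : Matrix (Fin 2) (Fin 2) ℂ →ₗ[ℂ] ℂ)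
        (prodCfg (Ucur (bgOfCfg F K U₀)) (((F.L : ℝ)⁻¹) ^ (K - n)) (curL (flat115 (Tc (A₁ + H1f F n K h c₀ cB a Δx U₀ B + (t : ℂ) • δ'))))))
      (pair27 (LinearMap.toContinuousLinearMap (Matrix.traceLinearMap (Fin 2) ℂ ℂ)) (Jcur (bgOfCfg F K U₀) : NegSize (F.L : ℝ) (((F.L : ℝ)⁻¹) ^ (K - n)) (fun _ : Bond 3 (periodsT3 F K) => K - n) 3 (Matrix (Fin 2) (Fin 2) ℂ)) (flat115 δ')
        + pair27 (LinearMap.toContinuousLinearMap (Matrix.traceLinearMap (Fin 2) ℂ ℂ))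
            (currentCLM frobEquiv (fun _ : Bond 3 (periodsT3 F K) × Fin 3 => K - n) (nabla115 (((F.L : ℝ)⁻¹) ^ (K - n)) (bgOfCfg F K U₀)) (Δx U₀) (A₁ + H1f F n K h c₀ cB a Δx U₀ B))
            (flat115 δ')
        + pair27 (LinearMap.toContinuousLinearMap (Matrix.traceLinearMap (Fin 2) ℂ ℂ)) (W (A₁ + H1f F n K h c₀ cB a Δx U₀ B)) (flat115 δ')) 0)
    (hchart : ∀ δ' : Space115 (F.L : ℝ) (((F.L : ℝ)⁻¹) ^ (K - n)) (fun _ : Bond 3 (periodsT3 F K) => K - n) (fun _ : Bond 3 (periodsT3 F K) × Fin 3 => K - n)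
        (nabla115 (((F.L : ℝ)⁻¹) ^ (K - n)) (bgOfCfg F K U₀)),
      (∀ b : PBond (F.P K) 0, star (JetSup.equiv _ _ _ δ' (bondEquiv F K b)) = JetSup.equiv _ _ _ δ' (bondEquiv F K b)) →
      (∀ b : PBond (F.P K) 0, Matrix.trace (JetSup.equiv _ _ _ δ' (bondEquiv F K b)) = 0) →
      QTwS F n K h U₀ (fun b : PBond (F.P K) 0 => JetSup.equiv _ _ _ δ' (bondEquiv F K b)) = 0 →
      ∀ᶠ t : ℝ in nhds 0,
        ((((eta F n K : ℝ) : ℂ)) * Complex.I) • (fun b : PBond (F.P K) 0 => JetSup.equiv _ _ _ (Tc (A₁ + H1f F n K h c₀ cB a Δx U₀ B + (t : ℂ) • δ')) (bondEquiv F K b))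
          = χ (((((eta F n K : ℝ) : ℂ)) * Complex.I) • ((fun b : PBond (F.P K) 0 => JetSup.equiv _ _ _ A₁ (bondEquiv F K b))
                + (fun b : PBond (F.P K) 0 => JetSup.equiv _ _ _ (H1f F n K h c₀ cB a Δx U₀ B) (bondEquiv F K b)))
              + (t : ℂ) • (((((eta F n K : ℝ) : ℂ)) * Complex.I) • fun b : PBond (F.P K) 0 => JetSup.equiv _ _ _ δ' (bondEquiv F K b))))
    (hXR : ∀ δ' : Space115 (F.L : ℝ) (((F.L : ℝ)⁻¹) ^ (K - n)) (fun _ : Bond 3 (periodsT3 F K) => K - n) (fun _ : Bond 3 (periodsT3 F K) × Fin 3 => K - n)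
        (nabla115 (((F.L : ℝ)⁻¹) ^ (K - n)) (bgOfCfg F K U₀)),
      (∀ b : PBond (F.P K) 0, star (JetSup.equiv _ _ _ δ' (bondEquiv F K b)) = JetSup.equiv _ _ _ δ' (bondEquiv F K b)) →
      (∀ b : PBond (F.P K) 0, Matrix.trace (JetSup.equiv _ _ _ δ' (bondEquiv F K b)) = 0) →
      QTwS F n K h U₀ (fun b : PBond (F.P K) 0 => JetSup.equiv _ _ _ δ' (bondEquiv F K b)) = 0 →
      ∀ᶠ t : ℝ in nhds 0, ∀ b' : PBond (F.P K) 0,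
        (((-Complex.I) • χ (((((eta F n K : ℝ) : ℂ)) * Complex.I) • ((fun b : PBond (F.P K) 0 => JetSup.equiv _ _ _ A₁ (bondEquiv F K b))
                + (fun b : PBond (F.P K) 0 => JetSup.equiv _ _ _ (H1f F n K h c₀ cB a Δx U₀ B) (bondEquiv F K b)))
              + (t : ℂ) • (((((eta F n K : ℝ) : ℂ)) * Complex.I) • fun b : PBond (F.P K) 0 => JetSup.equiv _ _ _ δ' (bondEquiv F K b)))) b').IsHermitian ∧
        Matrix.trace (((-Complex.I) • χ (((((eta F n K : ℝ) : ℂ)) * Complex.I) • ((fun b : PBond (F.P K) 0 => JetSup.equiv _ _ _ A₁ (bondEquiv F K b))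
                + (fun b : PBond (F.P K) 0 => JetSup.equiv _ _ _ (H1f F n K h c₀ cB a Δx U₀ B) (bondEquiv F K b)))
              + (t : ℂ) • (((((eta F n K : ℝ) : ℂ)) * Complex.I) • fun b : PBond (F.P K) 0 => JetSup.equiv _ _ _ δ' (bondEquiv F K b)))) b') = 0)
    (hCrit127 : ∀ δ : PBond (F.P K) 0 → Matrix (Fin 2) (Fin 2) ℂ, (∀ b', star (δ b') = -δ b' ∧ (δ b').trace = 0) → QTwS F n K h U₀ δ = 0 →
      deriv (fun t : ℝ => wilsonAction4 (emb15 U₀ (expHermField (fun b' : PBond (F.P K) 0 => (-Complex.I) •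
        (χ (((((eta F n K : ℝ) : ℂ)) * Complex.I) • ((fun b : PBond (F.P K) 0 => JetSup.equiv _ _ _ A₁ (bondEquiv F K b))
            + (fun b : PBond (F.P K) 0 => JetSup.equiv _ _ _ (H1f F n K h c₀ cB a Δx U₀ B) (bondEquiv F K b)))
          + (t : ℂ) • δ)) b')))) 0 = 0)
    (hXtr : ∀ b : PBond (F.P K) 0, Matrix.trace ((toL2 F K c₀).symm
      (Δx U₀ (toL2 F K c₀ ((fun b : PBond (F.P K) 0 => JetSup.equiv _ _ _ A₁ (bondEquiv F K b))
          + (fun b : PBond (F.P K) 0 => JetSup.equiv _ _ _ (H1f F n K h c₀ cB a Δx U₀ B) (bondEquiv F K b))))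
        + (funEquiv frobEquiv (fun _ : Bond 3 (periodsT3 F K) => c₀)).symm
            (NegSup.equiv _ _ (Jcur (L := (F.L : ℝ)) (η := ((F.L : ℝ)⁻¹) ^ (K - n)) (lev₀ := fun _ : Bond 3 (periodsT3 F K) => K - n) (bgOfCfg F K U₀))
              + NegSup.equiv _ _ (W (A₁ + H1f F n K h c₀ cB a Δx U₀ B)))) b) = 0) :
    ∃ μ : WL2 ℂ (fun _ : PBond (F.P n) 0 => cB) W₂,
      Δx U₀ (toL2 F K c₀ ((fun b : PBond (F.P K) 0 => JetSup.equiv _ _ _ A₁ (bondEquiv F K b))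
          + (fun b : PBond (F.P K) 0 => JetSup.equiv _ _ _ (H1f F n K h c₀ cB a Δx U₀ B) (bondEquiv F K b))))
        + (funEquiv frobEquiv (fun _ : Bond 3 (periodsT3 F K) => c₀)).symm
            (NegSup.equiv _ _ (Jcur (L := (F.L : ℝ)) (η := ((F.L : ℝ)⁻¹) ^ (K - n)) (lev₀ := fun _ : Bond 3 (periodsT3 F K) => K - n) (bgOfCfg F K U₀))
              + NegSup.equiv _ _ (W (A₁ + H1f F n K h c₀ cB a Δx U₀ B)))
      = LinearMap.adjoint (Qk F n K h c₀ cB U₀) μ := by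
  refine exists_eq_adjoint_Qk_of_hermitian_traceless U₀ hQ hQtr hQsc hXtr fun aH haR hatr haQ => ?_
  -- read the route direction `aH` as the (115)-direction `δ′ := aH ∘ bondEquiv⁻¹`
  set δ' : Space115 (F.L : ℝ) (((F.L : ℝ)⁻¹) ^ (K - n)) (fun _ : Bond 3 (periodsT3 F K) => K - n) (fun _ : Bond 3 (periodsT3 F K) × Fin 3 => K - n)
      (nabla115 (((F.L : ℝ)⁻¹) ^ (K - n)) (bgOfCfg F K U₀)) := fun p => aH ((bondEquiv F K).symm p) with hδ'
  have hι : (fun b : PBond (F.P K) 0 => JetSup.equiv _ _ _ δ' (bondEquiv F K b)) = aH := by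
    funext b
    show aH ((bondEquiv F K).symm (bondEquiv F K b)) = aH b
    rw [Equiv.symm_apply_apply]
  have hιb : ∀ b : PBond (F.P K) 0, JetSup.equiv _ _ _ δ' (bondEquiv F K b) = aH b := fun b => by
    show aH ((bondEquiv F K).symm (bondEquiv F K b)) = aH b
    rw [Equiv.symm_apply_apply]
  have haRb : ∀ b : PBond (F.P K) 0, star (aH b) = aH b := fun b => by
    have h1 := congrFun haR b
    rwa [Pi.star_apply] at h1
  have hδR : ∀ b : PBond (F.P K) 0, star (JetSup.equiv _ _ _ δ' (bondEquiv F K b)) = JetSup.equiv _ _ _ δ' (bondEquiv F K b) := fun b => by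
    rw [hιb b]
    exact haRb b
  have hδtr : ∀ b : PBond (F.P K) 0, Matrix.trace (JetSup.equiv _ _ _ δ' (bondEquiv F K b)) = 0 := fun b => by rw [hιb b]; exact hatr b
  have hδQ : QTwS F n K h U₀ (fun b : PBond (F.P K) 0 => JetSup.equiv _ _ _ δ' (bondEquiv F K b)) = 0 := by rw [hι]; exact haQ
  -- `hCrit127` at the route direction `δ := (η·i) • ιδ′` (skew-Hermitian, traceless, in `ker QTwS`)
  have hsR : ∀ b', star (((((( eta F n K : ℝ) : ℂ)) * Complex.I) • fun b : PBond (F.P K) 0 => JetSup.equiv _ _ _ δ' (bondEquiv F K b)) b')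
      = -((((( eta F n K : ℝ) : ℂ)) * Complex.I) • fun b : PBond (F.P K) 0 => JetSup.equiv _ _ _ δ' (bondEquiv F K b)) b' ∧
      Matrix.trace (((((( eta F n K : ℝ) : ℂ)) * Complex.I) • fun b : PBond (F.P K) 0 => JetSup.equiv _ _ _ δ' (bondEquiv F K b)) b') = 0 := fun b' => by
    have hstarc : star ((((eta F n K : ℝ) : ℂ)) * Complex.I) = -((((eta F n K : ℝ) : ℂ)) * Complex.I) := by simp
    simp only [Pi.smul_apply]
    refine ⟨?_, ?_⟩
    · rw [star_smul, hδR b', hstarc, neg_smul]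
    · rw [Matrix.trace_smul, hδtr b', smul_zero]
  have hsQ : QTwS F n K h U₀ (((((eta F n K : ℝ) : ℂ)) * Complex.I) • fun b : PBond (F.P K) 0 => JetSup.equiv _ _ _ δ' (bondEquiv F K b)) = 0 := by
    rw [map_smul, hδQ, smul_zero]
  have hmain := inner_toL2_residual_eq_zero_of_hCrit127_of_hasDerivAt_actionZ (h := h) (c₀ := c₀) (cB := cB) (a := a) (Δx := Δx) U₀ A₁ W Tc B χ hδR
    (hZ δ' hδR hδtr hδQ) (hchart δ' hδR hδtr hδQ) (hXR δ' hδR hδtr hδQ) (hCrit127 _ hsR hsQ)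
  rw [hι] at hmain
  exact hmain

/-- ★★ **S11's ROW `h128` AT `U₀ ∈ 𝔘_k(ε₀)`** in the windows `10⁹L²e ≤ 1`, `10¹²L³ε₀ ≤ 1`: as `exists_eq_adjoint_Qk_of_hCrit127_of_hasDerivAt_actionZ` with the three `QTwS` sector rows DISCHARGED
(✓`QTwS_star_comm_of_regPr`, ✓`QTwS_traceless_of_regPr`, ✓`QTwS_scalar_of_regPr`). [cite: Balaban1985Variational, (127)–(128) p.297, (129)–(130) pp.297–298, (84) p.290, (51) p.286; Balaban1985BackgroundPropagators, (3.13)–(3.15) p.393] -/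
theorem exists_eq_adjoint_Qk_of_hCrit127_of_hasDerivAt_actionZ_regPr
    {ε₀ e : ℝ} (hε₀ : 0 < ε₀) (he : 0 < e) (hWe : 10 ^ 9 * (F.L : ℝ) ^ 2 * e ≤ 1) (hWε : 10 ^ 12 * (F.L : ℝ) ^ 3 * ε₀ ≤ 1)
    (U₀ : GaugeField (F.P K) 0 (Matrix.specialUnitaryGroup (Fin 2) ℂ)) (hreg : RegPr F n K ε₀ U₀)
    (A₁ : Space115 (F.L : ℝ) (((F.L : ℝ)⁻¹) ^ (K - n)) (fun _ : Bond 3 (periodsT3 F K) => K - n) (fun _ : Bond 3 (periodsT3 F K) × Fin 3 => K - n)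
      (nabla115 (((F.L : ℝ)⁻¹) ^ (K - n)) (bgOfCfg F K U₀)))
    (W : Space115 (F.L : ℝ) (((F.L : ℝ)⁻¹) ^ (K - n)) (fun _ : Bond 3 (periodsT3 F K) => K - n) (fun _ : Bond 3 (periodsT3 F K) × Fin 3 => K - n)
        (nabla115 (((F.L : ℝ)⁻¹) ^ (K - n)) (bgOfCfg F K U₀)) →
      NegSize (F.L : ℝ) (((F.L : ℝ)⁻¹) ^ (K - n)) (fun _ : Bond 3 (periodsT3 F K) => K - n) 3 (Matrix (Fin 2) (Fin 2) ℂ))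
    (Tc : Space115 (F.L : ℝ) (((F.L : ℝ)⁻¹) ^ (K - n)) (fun _ : Bond 3 (periodsT3 F K) => K - n) (fun _ : Bond 3 (periodsT3 F K) × Fin 3 => K - n)
        (nabla115 (((F.L : ℝ)⁻¹) ^ (K - n)) (bgOfCfg F K U₀)) →
      Space115 (F.L : ℝ) (((F.L : ℝ)⁻¹) ^ (K - n)) (fun _ : Bond 3 (periodsT3 F K) => K - n) (fun _ : Bond 3 (periodsT3 F K) × Fin 3 => K - n)
        (nabla115 (((F.L : ℝ)⁻¹) ^ (K - n)) (bgOfCfg F K U₀)))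
    (B : PBond (F.P n) 0 → Matrix (Fin 2) (Fin 2) ℂ)
    (χ : (PBond (F.P K) 0 → Matrix (Fin 2) (Fin 2) ℂ) → (PBond (F.P K) 0 → Matrix (Fin 2) (Fin 2) ℂ))
    (hZ : ∀ δ' : Space115 (F.L : ℝ) (((F.L : ℝ)⁻¹) ^ (K - n)) (fun _ : Bond 3 (periodsT3 F K) => K - n) (fun _ : Bond 3 (periodsT3 F K) × Fin 3 => K - n)
        (nabla115 (((F.L : ℝ)⁻¹) ^ (K - n)) (bgOfCfg F K U₀)),
      (∀ b : PBond (F.P K) 0, star (JetSup.equiv _ _ _ δ' (bondEquiv F K b)) = JetSup.equiv _ _ _ δ' (bondEquiv F K b)) →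
      (∀ b : PBond (F.P K) 0, Matrix.trace (JetSup.equiv _ _ _ δ' (bondEquiv F K b)) = 0) →
      QTwS F n K h U₀ (fun b : PBond (F.P K) 0 => JetSup.equiv _ _ _ δ' (bondEquiv F K b)) = 0 →
      HasDerivAt (fun t : ℝ => actionZ Tsh (((F.L : ℝ)⁻¹) ^ (K - n)) 3
        ((LinearMap.toContinuousLinearMap (Matrix.traceLinearMap (Fin 2) ℂ ℂ) : Matrix (Fin 2) (Fin 2) ℂ →L[ℂ] ℂ) : Matrix (Fin 2) (Fin 2) ℂ →ₗ[ℂ] ℂ)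
        (prodCfg (Ucur (bgOfCfg F K U₀)) (((F.L : ℝ)⁻¹) ^ (K - n)) (curL (flat115 (Tc (A₁ + H1f F n K h c₀ cB a Δx U₀ B + (t : ℂ) • δ'))))))
      (pair27 (LinearMap.toContinuousLinearMap (Matrix.traceLinearMap (Fin 2) ℂ ℂ)) (Jcur (bgOfCfg F K U₀) : NegSize (F.L : ℝ) (((F.L : ℝ)⁻¹) ^ (K - n)) (fun _ : Bond 3 (periodsT3 F K) => K - n) 3 (Matrix (Fin 2) (Fin 2) ℂ)) (flat115 δ')
        + pair27 (LinearMap.toContinuousLinearMap (Matrix.traceLinearMap (Fin 2) ℂ ℂ))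
            (currentCLM frobEquiv (fun _ : Bond 3 (periodsT3 F K) × Fin 3 => K - n) (nabla115 (((F.L : ℝ)⁻¹) ^ (K - n)) (bgOfCfg F K U₀)) (Δx U₀) (A₁ + H1f F n K h c₀ cB a Δx U₀ B))
            (flat115 δ')
        + pair27 (LinearMap.toContinuousLinearMap (Matrix.traceLinearMap (Fin 2) ℂ ℂ)) (W (A₁ + H1f F n K h c₀ cB a Δx U₀ B)) (flat115 δ')) 0)
    (hchart : ∀ δ' : Space115 (F.L : ℝ) (((F.L : ℝ)⁻¹) ^ (K - n)) (fun _ : Bond 3 (periodsT3 F K) => K - n) (fun _ : Bond 3 (periodsT3 F K) × Fin 3 => K - n)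
        (nabla115 (((F.L : ℝ)⁻¹) ^ (K - n)) (bgOfCfg F K U₀)),
      (∀ b : PBond (F.P K) 0, star (JetSup.equiv _ _ _ δ' (bondEquiv F K b)) = JetSup.equiv _ _ _ δ' (bondEquiv F K b)) →
      (∀ b : PBond (F.P K) 0, Matrix.trace (JetSup.equiv _ _ _ δ' (bondEquiv F K b)) = 0) →
      QTwS F n K h U₀ (fun b : PBond (F.P K) 0 => JetSup.equiv _ _ _ δ' (bondEquiv F K b)) = 0 →
      ∀ᶠ t : ℝ in nhds 0,
        ((((eta F n K : ℝ) : ℂ)) * Complex.I) • (fun b : PBond (F.P K) 0 => JetSup.equiv _ _ _ (Tc (A₁ + H1f F n K h c₀ cB a Δx U₀ B + (t : ℂ) • δ')) (bondEquiv F K b))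
          = χ (((((eta F n K : ℝ) : ℂ)) * Complex.I) • ((fun b : PBond (F.P K) 0 => JetSup.equiv _ _ _ A₁ (bondEquiv F K b))
                + (fun b : PBond (F.P K) 0 => JetSup.equiv _ _ _ (H1f F n K h c₀ cB a Δx U₀ B) (bondEquiv F K b)))
              + (t : ℂ) • (((((eta F n K : ℝ) : ℂ)) * Complex.I) • fun b : PBond (F.P K) 0 => JetSup.equiv _ _ _ δ' (bondEquiv F K b))))
    (hXR : ∀ δ' : Space115 (F.L : ℝ) (((F.L : ℝ)⁻¹) ^ (K - n)) (fun _ : Bond 3 (periodsT3 F K) => K - n) (fun _ : Bond 3 (periodsT3 F K) × Fin 3 => K - n)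
        (nabla115 (((F.L : ℝ)⁻¹) ^ (K - n)) (bgOfCfg F K U₀)),
      (∀ b : PBond (F.P K) 0, star (JetSup.equiv _ _ _ δ' (bondEquiv F K b)) = JetSup.equiv _ _ _ δ' (bondEquiv F K b)) →
      (∀ b : PBond (F.P K) 0, Matrix.trace (JetSup.equiv _ _ _ δ' (bondEquiv F K b)) = 0) →
      QTwS F n K h U₀ (fun b : PBond (F.P K) 0 => JetSup.equiv _ _ _ δ' (bondEquiv F K b)) = 0 →
      ∀ᶠ t : ℝ in nhds 0, ∀ b' : PBond (F.P K) 0,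
        (((-Complex.I) • χ (((((eta F n K : ℝ) : ℂ)) * Complex.I) • ((fun b : PBond (F.P K) 0 => JetSup.equiv _ _ _ A₁ (bondEquiv F K b))
                + (fun b : PBond (F.P K) 0 => JetSup.equiv _ _ _ (H1f F n K h c₀ cB a Δx U₀ B) (bondEquiv F K b)))
              + (t : ℂ) • (((((eta F n K : ℝ) : ℂ)) * Complex.I) • fun b : PBond (F.P K) 0 => JetSup.equiv _ _ _ δ' (bondEquiv F K b)))) b').IsHermitian ∧
        Matrix.trace (((-Complex.I) • χ (((((eta F n K : ℝ) : ℂ)) * Complex.I) • ((fun b : PBond (F.P K) 0 => JetSup.equiv _ _ _ A₁ (bondEquiv F K b))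
                + (fun b : PBond (F.P K) 0 => JetSup.equiv _ _ _ (H1f F n K h c₀ cB a Δx U₀ B) (bondEquiv F K b)))
              + (t : ℂ) • (((((eta F n K : ℝ) : ℂ)) * Complex.I) • fun b : PBond (F.P K) 0 => JetSup.equiv _ _ _ δ' (bondEquiv F K b)))) b') = 0)
    (hCrit127 : ∀ δ : PBond (F.P K) 0 → Matrix (Fin 2) (Fin 2) ℂ, (∀ b', star (δ b') = -δ b' ∧ (δ b').trace = 0) → QTwS F n K h U₀ δ = 0 →
      deriv (fun t : ℝ => wilsonAction4 (emb15 U₀ (expHermField (fun b' : PBond (F.P K) 0 => (-Complex.I) •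
        (χ (((((eta F n K : ℝ) : ℂ)) * Complex.I) • ((fun b : PBond (F.P K) 0 => JetSup.equiv _ _ _ A₁ (bondEquiv F K b))
            + (fun b : PBond (F.P K) 0 => JetSup.equiv _ _ _ (H1f F n K h c₀ cB a Δx U₀ B) (bondEquiv F K b)))
          + (t : ℂ) • δ)) b')))) 0 = 0)
    (hXtr : ∀ b : PBond (F.P K) 0, Matrix.trace ((toL2 F K c₀).symm
      (Δx U₀ (toL2 F K c₀ ((fun b : PBond (F.P K) 0 => JetSup.equiv _ _ _ A₁ (bondEquiv F K b))
          + (fun b : PBond (F.P K) 0 => JetSup.equiv _ _ _ (H1f F n K h c₀ cB a Δx U₀ B) (bondEquiv F K b))))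
        + (funEquiv frobEquiv (fun _ : Bond 3 (periodsT3 F K) => c₀)).symm
            (NegSup.equiv _ _ (Jcur (L := (F.L : ℝ)) (η := ((F.L : ℝ)⁻¹) ^ (K - n)) (lev₀ := fun _ : Bond 3 (periodsT3 F K) => K - n) (bgOfCfg F K U₀))
              + NegSup.equiv _ _ (W (A₁ + H1f F n K h c₀ cB a Δx U₀ B)))) b) = 0) :
    ∃ μ : WL2 ℂ (fun _ : PBond (F.P n) 0 => cB) W₂,
      Δx U₀ (toL2 F K c₀ ((fun b : PBond (F.P K) 0 => JetSup.equiv _ _ _ A₁ (bondEquiv F K b))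
          + (fun b : PBond (F.P K) 0 => JetSup.equiv _ _ _ (H1f F n K h c₀ cB a Δx U₀ B) (bondEquiv F K b))))
        + (funEquiv frobEquiv (fun _ : Bond 3 (periodsT3 F K) => c₀)).symm
            (NegSup.equiv _ _ (Jcur (L := (F.L : ℝ)) (η := ((F.L : ℝ)⁻¹) ^ (K - n)) (lev₀ := fun _ : Bond 3 (periodsT3 F K) => K - n) (bgOfCfg F K U₀))
              + NegSup.equiv _ _ (W (A₁ + H1f F n K h c₀ cB a Δx U₀ B)))
      = LinearMap.adjoint (Qk F n K h c₀ cB U₀) μ :=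
  exists_eq_adjoint_Qk_of_hCrit127_of_hasDerivAt_actionZ U₀ (QTwS_star_comm_of_regPr F h hε₀ he hWe hWε U₀ hreg) (QTwS_traceless_of_regPr F h hε₀ he hWe hWε U₀ hreg)
    (QTwS_scalar_of_regPr F h hε₀ hWε U₀ hreg) A₁ W Tc B χ hZ hchart hXR hCrit127 hXtr

end Summit.QuantumFields.YangMills.Theorems.Prop7Eq128AtMemberOfCrit127

end
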